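import Literature.Geometry.Kaehler.ComplexTorusCommutativeEndomorphismLefschetzGroupConnected
import Literature.Geometry.Kaehler.ComplexTorusSimpleEndomorphismCenter
import Literature.Geometry.Kaehler.ComplexTorusRosatiAlbert
import Literature.RingTheory.CentralSimple.AlbertTypes
import HarnessLib

/-!
# Milne's Summary table, the rows «I ∣ Sp ∣ Connected: Yes» and «IV ∣ GL ∣ Connected: Yes» (`d = 1`), in the
# Albert-type vocabulary: for a SIMPLE polarised complex torus whose endomorphism algebra is its own centre
# (`[End_ℚ(X) : K] = 1`: Albert type I, or type IV with `d = 1`), `Lf(X)(ℂ) = S(X)(ℂ)`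

Layer `Literature/Geometry/Kaehler`, namespace `Literature.Geometry.Kaehler.ComplexTorus`; lane `lit-hodgefound`
(Track 2 foundations library), Layer A4 (Lefschetz groups), skeleton seat `lit-hodgefound-skel-4` (generation 35),
row A4-94 (c) = the typed targets `IsSimple.lefschetzIdentityC_eq_lefschetzGroupC_of_isAlbertTypeI` and (for `d = 1`)
`…_of_isAlbertTypeIV` of GAP row A4-90. Sequel BY NAME of row A4-94 (b)
`ComplexTorusCommutativeEndomorphismLefschetzGroupConnected` (`IsRiemannForm.lefschetzIdentityC_eq_lefschetzGroupC_of_endAlgRat_comm'`: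
a polarised torus with COMMUTATIVE endomorphism algebra has `Lf = S`), of `ComplexTorusSimpleEndomorphismCenter`
(`centerField`, `centerField.val_comm`, `centerField.coe_algebraMap`), `ComplexTorusRosatiAlbert` (`rosatiEnd`) and
`Literature.RingTheory.CentralSimple.AlbertTypes` (`IsAlbertTypeI`, `IsAlbertTypeIV`). THEOREMS ONLY (no definition,
no named fact; net debt 0).

## Sources, verbatim

* [Milne1999LefschetzClasses] J. S. Milne, *Lefschetz classes on abelian varieties*, Duke Math. J. 96 (1999), §2
  «Simple abelian variety of type I. In this case `E = F`» (p. 648), «Simple abelian variety of type IV» (p. 651),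
  Summary table (p. 652): «Type ∣ Group ∣ Semisimple ∣ Connected […] I ∣ Sp ∣ Yes ∣ Yes […] IV ∣ GL ∣ No ∣ Yes».
* [Lange2023AbelianVarietiesComplex] H. Lange, *Abelian Varieties over the Complex Numbers* (2023), Thm. 2.6.5 (a)
  («`F` is a totally real number field and the anti-involution is the identity»: type I), §2.6.1 table, §7.2.4
  Exercise (4).

## What is proved

* `IsSimple.endAlgRat_comm_of_finrank_eq_one`: `[End_ℚ(X) : K] = 1` (the endomorphism algebra is its centre `K`)
  makes `End_ℚ(X)` commutative.
* **`IsSimple.lefschetzIdentityC_eq_lefschetzGroupC_of_finrank_eq_one`** (`Lf(X)(ℂ) = S(X)(ℂ)` whenever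
  `[End_ℚ(X) : K] = 1` — types I and IV with `d = 1` at once), its irreducibility and real-points forms, and the
  typed specialisations **`IsSimple.lefschetzIdentityC_eq_lefschetzGroupC_of_isAlbertTypeI`** and
  **`IsSimple.lefschetzIdentityC_eq_lefschetzGroupC_of_isAlbertTypeIV_of_finrank_eq_one`**.

NOT here: type II (`ComplexTorusLefschetzGroupMatrixUnitFamilyConnected`, p36) and type IV with `d > 1`.
-/

noncomputable section

open Matrix
open Literature.RingTheory.CentralSimple (IsAlbertTypeI IsAlbertTypeIV)

namespace Literature.Geometry.Kaehler

namespace ComplexTorus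

section CentreIsAll

variable {κ : Type} [Fintype κ] [DecidableEq κ] [Nonempty κ] {E : Type*} [NormedAddCommGroup E] [NormedSpace ℂ E]
  {Ψ : (κ → ℝ) ≃L[ℝ] E} {η : E [⋀^Fin 2]→L[ℝ] ℝ} {G : Matrix κ κ ℚ}

/-- **`[End_ℚ(X) : K] = 1` makes `End_ℚ(X) = K` commutative** («Simple abelian variety of type I. In this case
`E = F`»; type IV with `d = 1`: `E = K`). [cite: Milne1999LefschetzClasses, §2 type I (p. 648) and type IV (p. 651)]
[cite: Lange2023AbelianVarietiesComplex, Thm. 2.6.5 (a)] -/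
theorem IsSimple.endAlgRat_comm_of_finrank_eq_one (hX : IsSimple Ψ)
    (h1 : Module.finrank (centerField Ψ hX) (endAlgRat Ψ) = 1) :
    ∀ a ∈ endAlgRat Ψ, ∀ b ∈ endAlgRat Ψ, a * b = b * a := by
  intro a ha b hb
  rcases eq_or_ne (1 : endAlgRat Ψ) 0 with h10 | h10
  · haveI := subsingleton_of_zero_eq_one h10.symm
    have ha0 : a = 0 := congrArg Subtype.val (Subsingleton.elim (⟨a, ha⟩ : endAlgRat Ψ) 0)
    rw [ha0, Matrix.zero_mul, Matrix.mul_zero]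
  · obtain ⟨z, hz⟩ := (finrank_eq_one_iff_of_nonzero' (1 : endAlgRat Ψ) h10).1 h1 ⟨a, ha⟩
    have haz : a = centerField.val Ψ hX z := by
      rw [← centerField.coe_algebraMap, Algebra.algebraMap_eq_smul_one, hz]
    rw [haz]
    exact centerField.val_comm Ψ hX z hb

/-- **MILNE'S TABLE FOR `E = K`: `Lf(X)(ℂ) = S(X)(ℂ)` for a simple polarised complex torus whose endomorphism
algebra is its own centre** (`[End_ℚ(X) : K] = 1`: Albert type I, `E = F` totally real — «I ∣ Sp ∣ Yes ∣ Yes» —, or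
Albert type IV with `d = 1`, `E = K` a CM field — «IV ∣ GL ∣ No ∣ Yes»). [cite: Milne1999LefschetzClasses, §2 type I (p. 648–649), type IV (p. 651) and Summary table (p. 652)]
[cite: Lange2023AbelianVarietiesComplex, §7.2.4 Exercise (4)] -/
theorem IsSimple.lefschetzIdentityC_eq_lefschetzGroupC_of_finrank_eq_one (hX : IsSimple Ψ) (hη : IsRiemannForm Ψ η)
    (hG : G.map (Rat.cast : ℚ → ℝ) = latticeGram Ψ η) (h1 : Module.finrank (centerField Ψ hX) (endAlgRat Ψ) = 1) :
    lefschetzIdentityC Ψ G = lefschetzGroupC Ψ G :=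
  hη.lefschetzIdentityC_eq_lefschetzGroupC_of_endAlgRat_comm' hG (hX.endAlgRat_comm_of_finrank_eq_one h1)

/-- The same, irreducibility form: `I_ℂ(S(X)(ℂ))` is prime. [cite: Milne1999LefschetzClasses, §2 Summary table (p. 652)] -/
theorem IsSimple.isPrime_vanishingIdealC_lefschetzGroupC_of_finrank_eq_one (hX : IsSimple Ψ)
    (hη : IsRiemannForm Ψ η) (hG : G.map (Rat.cast : ℚ → ℝ) = latticeGram Ψ η)
    (h1 : Module.finrank (centerField Ψ hX) (endAlgRat Ψ) = 1) :
    (vanishingIdealC (lefschetzGroupC Ψ G)).IsPrime :=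
  hη.isPrime_vanishingIdealC_lefschetzGroupC_of_endAlgRat_comm' hG (hX.endAlgRat_comm_of_finrank_eq_one h1)

/-- The same on real points: `Lf(X)(ℝ) = S(X)(ℝ) = lefschetzGroup Ψ η`. [cite: Milne1999LefschetzClasses, §2 Summary table (p. 652)]
[cite: Lange2023AbelianVarietiesComplex, §7.2.4 Exercise (4)] -/
theorem IsSimple.lefschetzIdentity_eq_lefschetzGroup_of_finrank_eq_one (hX : IsSimple Ψ) (hη : IsRiemannForm Ψ η)
    (hG : G.map (Rat.cast : ℚ → ℝ) = latticeGram Ψ η) (h1 : Module.finrank (centerField Ψ hX) (endAlgRat Ψ) = 1) :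
    lefschetzIdentity Ψ G = lefschetzGroup Ψ η :=
  hη.lefschetzIdentity_eq_lefschetzGroup_of_endAlgRat_comm' hG (hX.endAlgRat_comm_of_finrank_eq_one h1)

/-- **MILNE'S TABLE, TYPE I: `Lf(X)(ℂ) = S(X)(ℂ)` for a simple polarised complex torus of Albert type I** (`E = F`
a totally real number field, Rosati involution the identity; «I ∣ Sp_{2g/f} ∣ Yes ∣ Yes»). This is GAP row A4-90's
typed target for type I. [cite: Milne1999LefschetzClasses, §2 «Simple abelian variety of type I» (p. 648–649) and Summary table (p. 652)]
[cite: Lange2023AbelianVarietiesComplex, Thm. 2.6.5 (a), §7.2.4 Exercise (4)] -/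
theorem IsSimple.lefschetzIdentityC_eq_lefschetzGroupC_of_isAlbertTypeI (hX : IsSimple Ψ) (hη : IsRiemannForm Ψ η)
    (hG : G.map (Rat.cast : ℚ → ℝ) = latticeGram Ψ η)
    (h : IsAlbertTypeI (centerField Ψ hX) (endAlgRat Ψ) (rosatiEnd Ψ hη.1 hη.2.2 hG)) :
    lefschetzIdentityC Ψ G = lefschetzGroupC Ψ G :=
  hX.lefschetzIdentityC_eq_lefschetzGroupC_of_finrank_eq_one hη hG h.finrank_eq_one

/-- Type I, irreducibility form: `I_ℂ(S(X)(ℂ))` is prime («Connected: Yes»). [cite: Milne1999LefschetzClasses, §2 Summary table (p. 652)] -/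
theorem IsSimple.isPrime_vanishingIdealC_lefschetzGroupC_of_isAlbertTypeI (hX : IsSimple Ψ) (hη : IsRiemannForm Ψ η)
    (hG : G.map (Rat.cast : ℚ → ℝ) = latticeGram Ψ η)
    (h : IsAlbertTypeI (centerField Ψ hX) (endAlgRat Ψ) (rosatiEnd Ψ hη.1 hη.2.2 hG)) :
    (vanishingIdealC (lefschetzGroupC Ψ G)).IsPrime :=
  hX.isPrime_vanishingIdealC_lefschetzGroupC_of_finrank_eq_one hη hG h.finrank_eq_one

/-- Type I on real points: `Lf(X)(ℝ) = S(X)(ℝ)`. [cite: Milne1999LefschetzClasses, §2 type I («`S(A) = S₁ × ⋯ × S_t`, `S_i = Res_{F_i/k} Sp(φ_i)`») and Summary table] -/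
theorem IsSimple.lefschetzIdentity_eq_lefschetzGroup_of_isAlbertTypeI (hX : IsSimple Ψ) (hη : IsRiemannForm Ψ η)
    (hG : G.map (Rat.cast : ℚ → ℝ) = latticeGram Ψ η)
    (h : IsAlbertTypeI (centerField Ψ hX) (endAlgRat Ψ) (rosatiEnd Ψ hη.1 hη.2.2 hG)) :
    lefschetzIdentity Ψ G = lefschetzGroup Ψ η :=
  hX.lefschetzIdentity_eq_lefschetzGroup_of_finrank_eq_one hη hG h.finrank_eq_one

/-- **MILNE'S TABLE, TYPE IV WITH `d = 1`: `Lf(X)(ℂ) = S(X)(ℂ)` for a simple polarised complex torus of Albert type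
IV whose endomorphism algebra is the CM field `K` itself** (`[E : K] = d² = 1`; «IV ∣ GL_{g/f} ∣ No ∣ Yes»). The
type-IV structure enters only through `d = 1`; the general `d` is GAP row A4-90 (IV, `d > 1`).
[cite: Milne1999LefschetzClasses, §2 «Simple abelian variety of type IV» (p. 651) and Summary table (p. 652)] -/
theorem IsSimple.lefschetzIdentityC_eq_lefschetzGroupC_of_isAlbertTypeIV_of_finrank_eq_one (hX : IsSimple Ψ)
    (hη : IsRiemannForm Ψ η) (hG : G.map (Rat.cast : ℚ → ℝ) = latticeGram Ψ η)
    (h : IsAlbertTypeIV (centerField Ψ hX) (endAlgRat Ψ) (rosatiEnd Ψ hη.1 hη.2.2 hG))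
    (hd : Module.finrank (centerField Ψ hX) (endAlgRat Ψ) = 1) :
    lefschetzIdentityC Ψ G = lefschetzGroupC Ψ G := by
  have _ := h.isCMField
  exact hX.lefschetzIdentityC_eq_lefschetzGroupC_of_finrank_eq_one hη hG hd

end CentreIsAll

end ComplexTorus

end Literature.Geometry.Kaehler
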